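import Summits.BirchSwinnertonDyer.BirchSwinnertonDyer.Theorems.AlignedTransportAtTwoMainConjectureOfRankZeroBSDAtTwoTwistSaturation
import Summits.BirchSwinnertonDyer.BirchSwinnertonDyer.Theorems.AlignedTransportAtTwoMainConjectureOfRankZeroBSDAtTwoSelmerTwoOfBSDp
import Summits.BirchSwinnertonDyer.BirchSwinnertonDyer.Theorems.PublishedInputsGreenbergCharValueRankZeroNoTorsion
import Literature.NumberTheory.EllipticCurves.LeadingTermPPartProofs
import HarnessLib

/-!
# Route `AlignedTransportAtTwo`, crux C2 `MainConjectureOfRankZeroBSDAtTwo` (stmt-BirchSwinnertonDyer-22298):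
# THE TWIST-SATURATION DOOR IN THE CELL'S `L`-VALUE CURRENCY — `r_an(W) = 0`, `BSD(W,2)`, `∏c_ℓ` odd, `ord₂(L(W,1)/Ω_W) = 0` and
# `2·ord₂ #Ẽ(𝔽₂) ≤ rank W⁽²⁾(ℚ)` ⟹ `μ(X(W/ℚ_∞)) = 0`, `char X = ((T+2)^{2·ord₂ #Ẽ(𝔽₂)})`, and (mod PRINT) `MazurMainConjecture W 2`

HONEST FRAMING (cell `bsd-f1-sign2`, WIDTH-5 attached prover seat `bsd-line-att-p5` gen 46 on line `birth` of the lead `bsd-line-att-p2`;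
`--supports` stmt-BirchSwinnertonDyer-22298, closes nothing; BSD is NOT proved by any of this; the crux C2, its verdict «blocked-on
`Rank1Residual.GreenbergMuConjectureIrreducible`» and every registered stub are untouched). THEOREMS ONLY — no `def`, no instance, no named fact, no `sorry`.

Sequel of `…TwistSaturation` (this gen, p811907): there the door is stated with the exponents `t, e, s` of `#W(ℚ)[2^∞]`, `#Ẽ(𝔽₂)[2^∞]`,
`#Sel_{2^∞}(W/ℚ)` as data. On the seed cell these are READ OFF the cell's own binders: `t = 0` (no rational point of order `2` ⟹ `E[2]` irreducible
⟹ `E(ℚ)[2] = 0`), `e = ord₂ #Ẽ(𝔽₂)` (tree `natCard_primaryComponent_reduction_eq_pow`), and `s = 0` from `BSD(W,2)` + `r_an = 0` + `∏c_ℓ` odd +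
«`L(W,1)/Ω_W = q`, `ord₂ q = 0`» (g30 `…SelmerTwoOfBSDp`: `#Ш(W/ℚ)[2^∞] = 1`, and `#Sel_{2^∞}(W/ℚ) = #Ш(W/ℚ)[2^∞]` in rank `0`, tree
`natCard_selmerGroupPInfty_eq_natCard_primaryComponent_sha`). So the per-seed certificate is: the `L`-VALUE BIT the lineage's road rows already
display (`hL`), `∏c_ℓ` odd, and `2·ord₂ #Ẽ(𝔽₂)` INDEPENDENT RATIONAL POINTS ON THE TWIST (`= 2` for `a₂ = +1`, `= 4` for `a₂ = −1`).

* `natCard_selmerGroupPInfty_two_eq_one_of_bsdp_of_lValue` — `#Sel_{2^∞}(W/ℚ) = 1` on such a seed (g30's `Ш`-count in `Sel_{2^∞}` currency).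
* ★★★ `forall_mu_eq_zero_of_bsdp_of_lValue_of_le_mordellWeilRank_twist` — **`μ(X(W/ℚ_∞)) = 0`, `λ = rank W₂(ℚ)`, `char X = ((T+2)^{rank W₂(ℚ)})`**
  at every normalised cyclotomic dual datum, from `BSD(W,2)` + GZK + the `L`-value bit + `2·ord₂ #Ẽ(𝔽₂) ≤ rank W₂(ℚ)` (no Kato, no modular symbol).
* ★★★ `mazurMainConjecture_two_of_bsdp_of_lValue_of_le_mordellWeilRank_twist` — the same ⟹ **`MazurMainConjecture W 2`** modulo PRINT
  {`h17`, `hper`, `hmod`, `hGZK`} (Greenberg Thm. 4.1 is the tree theorem); the shape instantiated by the row file `…TwistSaturationRow503`.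

References: R. Greenberg, LNM 1716 (1999), Thm. 1.4, 1.9, 4.1, §4 p. 107 [GreenbergLNM1716]; K. Kato, Astérisque 295 (2004), Thm. 17.4
[Kato2004Asterisque]; R. L. Miller, LMS J. Comput. Math. 14 (2011), Def. 1.1 [Miller2011LMS]; J. H. Silverman, AEC (2009), X.4.2 [SilvermanAEC2009].
-/

set_option linter.dupNamespace false
set_option autoImplicit false

noncomputable section

open scoped Classical MatrixGroups ModularForm

namespace Summit.BirchSwinnertonDyer.BirchSwinnertonDyer.Theorems.AlignedTransportAtTwoTwistSaturation

open PowerSeries CongruenceSubgroup WeierstrassCurve Literature.NumberTheory.EllipticCurves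
  Literature.NumberTheory.EllipticCurves.ModularForms
  Literature.NumberTheory.EllipticCurves.Rank1Residual
  Literature.NumberTheory.EllipticCurves.Rank1Residual.Typed
  Literature.NumberTheory.EllipticCurves.Greenberg1999
  Literature.NumberTheory.EllipticCurves.Module
  Literature.NumberTheory.EllipticCurves.IwasawaAlgebra
  Summit.BirchSwinnertonDyer.Rank1Residual
  Summit.BirchSwinnertonDyer.Rank1Residual.X1.MuLambda
  Summit.BirchSwinnertonDyer.Rank1Residual.X5
  Summit.BirchSwinnertonDyer.Rank1Residual.F1Sign2
  Summit.BirchSwinnertonDyer.Rank1Residual.Iwasawa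
  Summit.BirchSwinnertonDyer.BirchSwinnertonDyer.Theorems.Rank1ResidualX1Defs
  Summit.BirchSwinnertonDyer.BirchSwinnertonDyer.Theorems.AlignedTransportAtTwoSeed
  Summit.BirchSwinnertonDyer.BirchSwinnertonDyer.Theorems.AlignedTransportAtTwoSelmerTwoOfBSDp
  Summit.BirchSwinnertonDyer.BirchSwinnertonDyer.Theorems.InputsGreenbergCharValue

variable (W W₂ : WeierstrassCurve ℚ) [W.IsElliptic] [W.IsGloballyMinimal] [W₂.IsElliptic] {V : VariableChange ℚ}
  (hV : V • W₂ = W.quadraticTwist 2)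

omit [W₂.IsElliptic] [W.IsGloballyMinimal] in
/-- **`#Sel_{2^∞}(W/ℚ) = 1` on a clean rank-`0` `BSD₂` seed.** `W` globally minimal, no rational point of order `2`, `r_an(W) = 0`, `BSD(W,2)`,
`∏c_ℓ` odd, `L(W,1)/Ω_W = q` with `q ≠ 0`, `ord₂ q = 0`: then `Ш(W/ℚ)[2^∞] = 0` (g30) and `Sel_{2^∞}(W/ℚ) ≅ Ш(W/ℚ)[2^∞]` in rank `0`.
[cite: Miller2011LMS, Def. 1.1] [cite: GreenbergLNM1716, §1 pp. 54–57] -/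
theorem natCard_selmerGroupPInfty_two_eq_one_of_bsdp_of_lValue (ht : ∀ x : ℚ, ¬ HasRationalTwoTorsionX W x)
    (hr : W.analyticRank = 0) (hbsd : BSDp W 2) (htam : Odd W.tamagawaProduct)
    (hL : ∃ q : ℚ, q ≠ 0 ∧ W.entireLFunction 1 / (W.realPeriodRat : ℂ) = (q : ℂ) ∧ padicValRat 2 q = 0) :
    Nat.card (W.selmerGroupPInfty 2) = 1 := by
  obtain ⟨q, hq0, hLq, hqv⟩ := hL
  have hr0 : W.mordellWeilRank = 0 := hbsd.1.trans hr
  haveI : Finite W.toAffine.Point := W.mordellWeilRank_eq_zero_iff_finite.mp hr0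
  have hirr : Irr W 2 := AlignedTransportAtTwoSelmerTwoOfBSDp.irr_two_of_forall_not_hasRationalTwoTorsionX W ht
  rw [natCard_selmerGroupPInfty_eq_natCard_primaryComponent_sha W 2]
  have hsha := shaAn_eq_of_analyticRank_eq_zero_of_lValue W hr0 hr hLq
  have hv := padicValRat_shaAn_eq_of_lValue W 2 hirr (not_two_dvd_tamagawaProduct_of_odd W htam) hq0
  exact natCard_primaryComponent_sha_eq_one_of_bsdp_of_shaAn_unit W 2 hbsd hsha (by rw [hv, hqv])

omit [W₂.IsElliptic] [W.IsGloballyMinimal] in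
/-- `#W(ℚ)[2^∞] = 1` when there is no rational point of order `2` (`E[2]` irreducible ⟹ no rational `2`-torsion, g30 `forall_zsmul_eq_zero_of_irr`).
[cite: SilvermanAEC2009, III.2.3 (b)] -/
theorem natCard_primaryComponent_point_two_eq_one (ht : ∀ x : ℚ, ¬ HasRationalTwoTorsionX W x) :
    Nat.card (AddCommGroup.primaryComponent W.toAffine.Point 2) = 1 := by
  have hirr : Irr W 2 := AlignedTransportAtTwoSelmerTwoOfBSDp.irr_two_of_forall_not_hasRationalTwoTorsionX W ht
  have hz := forall_zsmul_eq_zero_of_irr W 2 hirr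
  refine natCard_primaryComponent_point_eq_one_of_forall_smul_eq_zero 2 fun P hP => hz P ?_
  rw [show ((2 : ℕ) : ℤ) = ((2 : ℕ) : ℤ) from rfl, natCast_zsmul]
  convert hP

include hV in
/-- ★★★ **`μ = 0` FROM THE `L`-VALUE BIT AND POINTS ON THE TWIST.** `W` globally minimal, good ordinary at `2`, no rational point of order `2`,
`r_an(W) = 0`, `BSD(W,2)`, `∏c_ℓ` odd, `L(W,1)/Ω_W = q` (`q ≠ 0`, `ord₂ q = 0`); GZK (`hGZK`, for the finiteness of `Sel_{2^∞}(W/ℚ)`); `W₂` any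
`ℚ`-model of `W⁽²⁾` with **`2·ord₂ #Ẽ(𝔽₂) ≤ rank W₂(ℚ)`**. Then at every normalised cyclotomic dual datum: `μ(X(W/ℚ_∞)) = 0`, `λ = rank W₂(ℚ)`,
`char_Λ X = ((T+2)^{rank W₂(ℚ)})`. (p811907 `forall_mu_eq_zero_of_le_mordellWeilRank_twist` with `t = 0`, `e = ord₂ #Ẽ(𝔽₂)`, `s = 0`, `v = 0`.)
[cite: GreenbergLNM1716, Thm. 1.9 (p. 63), Thm. 4.1 (p. 102), §4 p. 107] [cite: Miller2011LMS, Def. 1.1] -/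
theorem forall_mu_eq_zero_of_bsdp_of_lValue_of_le_mordellWeilRank_twist (hGZK : rank_eq_analyticRank_of_analyticRank_le_one)
    (hord : IsOrdinaryAt W 2) (ht : ∀ x : ℚ, ¬ HasRationalTwoTorsionX W x) (hr : W.analyticRank = 0) (hbsd : BSDp W 2)
    (htam : Odd W.tamagawaProduct)
    (hL : ∃ q : ℚ, q ≠ 0 ∧ W.entireLFunction 1 / (W.realPeriodRat : ℂ) = (q : ℂ) ∧ padicValRat 2 q = 0)
    (hsat : 2 * padicValNat 2 (W.reductionPointCount 2) ≤ W₂.mordellWeilRank) :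
    ∀ (κ : ZpExtension ℚ 2) (γ : Field.absoluteGaloisGroup ℚ), κ.IsCyclotomic → κ.IsTopGenerator γ →
      IsCyclotomicVariable 2 γ → ∀ D : W.SelmerDualData κ γ,
        D.mu = 0 ∧ D.lambda = W₂.mordellWeilRank ∧ D.charIdeal = Ideal.span {(X + C (2 : ℤ_[2])) ^ W₂.mordellWeilRank} := by
  have hfin : Finite (W.selmerGroupPInfty 2) := finite_selmerGroupPInfty_two_of_analyticRank_eq_zero W hGZK hr
  have ht0 : Nat.card (AddCommGroup.primaryComponent W.toAffine.Point 2) = 2 ^ 0 := by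
    rw [pow_zero]; exact natCard_primaryComponent_point_two_eq_one W ht
  have he := natCard_primaryComponent_reduction_eq_pow W 2
  have hs : Nat.card (W.selmerGroupPInfty 2) = 2 ^ 0 := by
    rw [pow_zero]; exact natCard_selmerGroupPInfty_two_eq_one_of_bsdp_of_lValue W ht hr hbsd htam hL
  have hv : padicValNat 2 W.tamagawaProduct = 0 :=
    padicValNat.eq_zero_of_not_dvd (not_two_dvd_tamagawaProduct_of_odd W htam)
  exact forall_mu_eq_zero_of_le_mordellWeilRank_twist W W₂ hV hord hfin ht0 he hs (by rw [hv]; omega)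

include hV in
/-- ★★★ **THE TWIST-SATURATION DOOR IN `L`-VALUE CURRENCY, modulo PRINT.** Seed-cell `W` (globally minimal, good ordinary at `2`, no rational
point of order `2`, `r_an(W) = 0`, `BSD(W,2)`), PRINT {`h17`, `hper`, `hmod`, `hGZK`}, the road rows' CERT {`∏c_ℓ` odd, `L(W,1)/Ω_W = q` with
`ord₂ q = 0`} and **`2·ord₂ #Ẽ(𝔽₂) ≤ rank W₂(ℚ)`** for a `ℚ`-model `W₂` of `W⁽²⁾` ⟹ **`MazurMainConjecture W 2`** (p811907's door with `t, e, s, v`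
read off the binders). For `a₂ = +1` the certificate is TWO independent rational points on the twist. [cite: Kato2004Asterisque, Thm. 17.4 (1)(2) (p. 273)]
[cite: GreenbergLNM1716, Thm. 4.1 (p. 102), §4 p. 107] [cite: Miller2011LMS, Def. 1.1] -/
theorem mazurMainConjecture_two_of_bsdp_of_lValue_of_le_mordellWeilRank_twist
    (h17 : ∀ [NeZero (W.conductorNorm ℤ)] (f : CuspForm (Gamma0 (W.conductorNorm ℤ)) 2),
      kato_divisibility_allPrimes W 2 (f := f))
    (hper : realPeriodRat_eq_unit_mul_plusPeriod_two) (hmod : nonempty_modularParametrizationData)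
    (hGZK : rank_eq_analyticRank_of_analyticRank_le_one) (hord : IsOrdinaryAt W 2)
    (ht : ∀ x : ℚ, ¬ HasRationalTwoTorsionX W x) (hr : W.analyticRank = 0) (hbsd : BSDp W 2)
    (htam : Odd W.tamagawaProduct)
    (hL : ∃ q : ℚ, q ≠ 0 ∧ W.entireLFunction 1 / (W.realPeriodRat : ℂ) = (q : ℂ) ∧ padicValRat 2 q = 0)
    (hsat : 2 * padicValNat 2 (W.reductionPointCount 2) ≤ W₂.mordellWeilRank) :
    MazurMainConjecture W 2 :=
  mazurMainConjecture_two_of_bsdp_of_mu_eq_zero W h17 TwoAdicEulerCharKernel.thm41_charValue_rankZero_anyPrime_holds hper hmod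
    hGZK hord ht hr hbsd fun κ γ hκ hγ hγ' D _ =>
      (forall_mu_eq_zero_of_bsdp_of_lValue_of_le_mordellWeilRank_twist W W₂ hV hGZK hord ht hr hbsd htam hL hsat κ γ hκ hγ hγ' D).1

end Summit.BirchSwinnertonDyer.BirchSwinnertonDyer.Theorems.AlignedTransportAtTwoTwistSaturation

end
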